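import Summits.MatrixMultiplication.MatrixMultiplication.Theorems.ObstructionDescentSlotCharacterDescent

set_option linter.dupNamespace false

/-!
# Obstruction descent, part AA — SLOT-CHARACTER TRANSFER: on low-rank tensors `S₃` acts on the level space `R_k(N)`
# through the character of the corner space `R_k(N−1)` (isotypic descent)

`route-MatrixMultiplication-ObstructionDescent`, aside `InvariantSaturation` (stmt 32282); decomp-mm lens-3, NODE-g16.  Part Z
proved the CLASH law: a level-`k` vector `f` of format `m' + 1` with its own slot character `χ ≠ χ'` (`χ'` = the character of
`σ` on the corner level space `R_k(m')`) vanishes on `σ_r`, `(k−1)r < k(m'+1)`.  The same window identity gives MORE, with NO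
hypothesis on `f` and no `dim ≤ 1` assumption on `R_k(m'+1)`:

* `restrictB_transfer` (§1): at a slot-symmetric base point, `restrictB N₂ x (f^σ − χ'·f) = 0` as soon as `σ` acts by `χ'` on a
  space containing the window function `restrictB N₂ x f` — the unit window of `g := f^σ − χ'·f ∈ R_k(m'+1)` is DEAD;
* **`evalT_permT_eq_slotChar_mul`** (§2) — SLOT-CHARACTER TRANSFER LAW: for EVERY `f ∈ R_k(m'+1)` and every tensor `t` with
  `R(t) ≤ r`, `(k−1)·r < k·(m'+1)`:  `f(σ·t) = χ' · f(t)`.  In words: restricted to `σ_r`, the `S₃`-module `R_k(m'+1)` is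
  `χ'`-ISOTYPIC — every other isotypic component lies in `I(σ_r)` (part Z's clash law is the eigenvector case); corner form
  at every ambient format (`…_corner`, via `cornerOf_permT`);
* §3 consequences: `evalT_eq_zero_of_permT_eq_self` — if `χ' ≠ 1`, EVERY level-`k` vector of format `m' + 1` vanishes at every
  `σ`-SYMMETRIC tensor of rank `≤ r` (e.g. at the unit tensor `⟨m'+1⟩` itself, `evalT_unitTensor_eq_zero_of_slotChar_ne_one`,
  and at all `S₃`-symmetric points); `evalT_permT_eq_of_slotChar_one` — if `χ' = 1`, level-`k` functions are `σ`-symmetric on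
  `σ_r`;
* §4 the record at level `3`: format `5` over the corner `R₃(4) = ℂ·G₄` (transposition character `−1`, census I42/I45):
  every level-`3` function of format `5` is transposition-ODD on `σ₇` (`evalT_permT_level_three_five`), hence vanishes at every
  transposition-symmetric tensor of rank `≤ 7`; format `6` over `R₃(5) = ℂ·H₅` (character `+1`): level-`3` functions of format
  `6` are transposition-EVEN on `σ₈` (`evalT_permT_level_three_six`).  Both are consistent with the record (`χ(H₅) = +1` forces
  `H₅|_{σ₇} = 0` = part Z; `χ(F₆) = +1`).

[cite: BurgisserIkenmeyer2011, §3.1–3.2, §6.2], [cite: BurgisserIkenmeyer2017, §5 (5.2), Thm 5.3], [cite: LandsbergGCT2017, §2.1,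
§8.3] (permutation symmetry of tensors; prolongation).
-/

noncomputable section

open scoped BigOperators
open Finset

namespace Summit.MatrixMultiplication.MatrixMultiplication.Theorems.ObstructionCalculus

open Literature.Computability.AlgebraicComplexity (actTensor triad triad_apply tensorRank unitTensor
  tensorRestrictsTo_actTensor TensorRestrictsTo)

variable {m : ℕ}

/-! ### §1 The window identity -/

/-- **Window identity.**  At a `σ`-fixed base point `x`, if `σ` acts by `χ'` on a space `V` containing the window function
`restrictB N₂ x f`, then the window function of `f^σ − χ'·f` vanishes identically. [this node] -/
theorem restrictB_transfer (N₂ : ℕ) (σ : Equiv.Perm (Fin 3)) {x : Tensor ℂ m} (hx : permT σ x = x)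
    {V : Submodule ℂ (MvPolynomial (Idx m) ℂ)} {χ' : ℂ}
    (hV : ∀ G ∈ V, MvPolynomial.rename (slotPerm σ) G = χ' • G) {f : MvPolynomial (Idx m) ℂ}
    (hW : restrictB N₂ x f ∈ V) : restrictB N₂ x (MvPolynomial.rename (slotPerm σ) f - χ' • f) = 0 := by
  rw [map_sub, map_smul, ← rename_slotPerm_restrictB_of_fixed N₂ σ hx, hV _ hW, sub_self]

/-- `f^σ − χ'·f` stays in the level space (level spaces are `S₃`-stable, part Y). [bookkeeping] -/
theorem rename_sub_smul_mem_level {N k : ℕ} (σ : Equiv.Perm (Fin 3)) (χ' : ℂ) {f : MvPolynomial (Idx m) ℂ}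
    (hf : f ∈ hwvSpace (rectType m N k) (k * N)) :
    MvPolynomial.rename (slotPerm σ) f - χ' • f ∈ hwvSpace (rectType m N k) (k * N) :=
  Submodule.sub_mem _ (rename_slotPerm_mem_level hf σ) (Submodule.smul_mem _ _ hf)

/-- The top corner of a slot-permuted tensor. [bookkeeping] -/
theorem cornerOf_permT (d : ℕ) (σ : Equiv.Perm (Fin 3)) (t : Tensor ℂ (d + m)) :
    cornerOf d (permT σ t) = permT σ (cornerOf d t) := by
  funext a b c
  have h : ∀ j : Fin 3, slot j ((Fin.natAdd d a, Fin.natAdd d b, Fin.natAdd d c) : Idx (d + m)) =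
      Fin.natAdd d (slot j (a, b, c)) := fun j => slot_liftI d j (a, b, c)
  simp only [cornerOf, permT_apply, h]

/-! ### §2 The transfer law -/

section Transfer

variable {m' : ℕ}

/-- The unit window of `f^σ − χ'·f` is dead, for every `f ∈ R_k(m'+1)`, once `σ` acts by `χ'` on the corner space `R_k(m')`.
[this node] -/
theorem unitWindow_dead_transfer {k : ℕ} (σ : Equiv.Perm (Fin 3)) {χ' : ℂ}
    (hV : ∀ G ∈ hwvSpace (rectType (m' + 1) m' k) (k * m'), MvPolynomial.rename (slotPerm σ) G = χ' • G)
    {f : MvPolynomial (Idx (m' + 1)) ℂ} (hf : f ∈ hwvSpace (rectType (m' + 1) (m' + 1) k) (k * (m' + 1)))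
    (y : Tensor ℂ (m' + 1)) :
    evalT ((fun a b c => if a = 0 ∨ b = 0 ∨ c = 0 then 0 else y a b c) +
      triad (Pi.single (0 : Fin (m' + 1)) (1 : ℂ)) (Pi.single 0 1) (Pi.single 0 1))
      (MvPolynomial.rename (slotPerm σ) f - χ' • f) = 0 := by
  have hW : restrictB m' (triad (Pi.single (0 : Fin (m' + 1)) (1 : ℂ)) (Pi.single 0 1) (Pi.single 0 1)) f ∈
      hwvSpace (rectType (m' + 1) m' k) (k * m') :=
    restrictB_mem_hwvSpace (Nat.le_succ m') (Nat.le_succ m') (triad_single_zero_mem_blockDiag m') hf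
  have h0 := restrictB_transfer m' σ (permT_triad_diag σ _) hV hW
  rw [← mixT_triad_single_zero, ← evalT_restrictB, h0, map_zero]

/-- **SLOT-CHARACTER TRANSFER LAW.**  If `σ ∈ S₃` acts by the scalar `χ'` on the corner level space
`hwvSpace (rectType (m'+1) m' k) (k m')`, then EVERY level-`k` vector `f` of format `m' + 1` satisfies `f(σ·t) = χ'·f(t)` for all
tensors `t` of rank `≤ r`, `(k−1)·r < k·(m'+1)`: on `σ_r` the `S₃`-module `R_k(m'+1)` is `χ'`-isotypic. [this node] -/
theorem evalT_permT_eq_slotChar_mul {k : ℕ} (σ : Equiv.Perm (Fin 3)) {χ' : ℂ}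
    (hV : ∀ G ∈ hwvSpace (rectType (m' + 1) m' k) (k * m'), MvPolynomial.rename (slotPerm σ) G = χ' • G)
    {f : MvPolynomial (Idx (m' + 1)) ℂ} (hf : f ∈ hwvSpace (rectType (m' + 1) (m' + 1) k) (k * (m' + 1)))
    {r : ℕ} (hr : (k - 1) * r < k * (m' + 1)) {t : Tensor ℂ (m' + 1)} (ht : tensorRank t ≤ r) :
    evalT (permT σ t) f = χ' * evalT t f := by
  have h := evalT_eq_zero_of_unitWindow (rename_sub_smul_mem_level σ χ' hf) (a := 0) (b := 0) (c := 0)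
    (fun y => unitWindow_dead_transfer σ hV hf y) hr ht
  rwa [map_sub, map_smul, evalT_rename_slotPerm, smul_eq_mul, sub_eq_zero] at h

/-- Corner form at every ambient format `m ≥ m' + 1`. [this node] -/
theorem evalT_permT_eq_slotChar_mul_corner {m k : ℕ} (hNm : m' + 1 ≤ m) (σ : Equiv.Perm (Fin 3)) {χ' : ℂ}
    (hV : ∀ G ∈ hwvSpace (rectType (m' + 1) m' k) (k * m'), MvPolynomial.rename (slotPerm σ) G = χ' • G)
    {F : MvPolynomial (Idx m) ℂ} (hF : F ∈ hwvSpace (rectType m (m' + 1) k) (k * (m' + 1)))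
    {r : ℕ} (hr : (k - 1) * r < k * (m' + 1)) {t : Tensor ℂ m} (ht : tensorRank t ≤ r) :
    evalT (permT σ t) F = χ' * evalT t F := by
  obtain ⟨d, rfl⟩ : ∃ d, m = d + (m' + 1) := ⟨m - (m' + 1), by omega⟩
  obtain ⟨f, hf, rfl⟩ := exists_eq_liftPoly_of_mem_hwvSpace le_rfl hF
  rw [evalT_liftPoly, evalT_liftPoly, cornerOf_permT]
  exact evalT_permT_eq_slotChar_mul σ hV hf hr ((tensorRank_cornerOf_le d t).trans ht)

/-! ### §3 Consequences -/

/-- **Nontrivial corner character ⇒ vanishing at symmetric points.**  If `χ' ≠ 1`, every level-`k` vector of format `m' + 1`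
vanishes at every `σ`-SYMMETRIC tensor of rank `≤ r`, `(k−1)r < k(m'+1)`. [this node] -/
theorem evalT_eq_zero_of_permT_eq_self {k : ℕ} (σ : Equiv.Perm (Fin 3)) {χ' : ℂ} (hχ : χ' ≠ 1)
    (hV : ∀ G ∈ hwvSpace (rectType (m' + 1) m' k) (k * m'), MvPolynomial.rename (slotPerm σ) G = χ' • G)
    {f : MvPolynomial (Idx (m' + 1)) ℂ} (hf : f ∈ hwvSpace (rectType (m' + 1) (m' + 1) k) (k * (m' + 1)))
    {r : ℕ} (hr : (k - 1) * r < k * (m' + 1)) {t : Tensor ℂ (m' + 1)} (ht : tensorRank t ≤ r)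
    (hsym : permT σ t = t) : evalT t f = 0 := by
  have h := evalT_permT_eq_slotChar_mul σ hV hf hr ht
  rw [hsym] at h
  have h2 : (χ' - 1) * evalT t f = 0 := by rw [sub_mul, one_mul, ← h, sub_self]
  exact (mul_eq_zero.1 h2).resolve_left (sub_ne_zero.2 hχ)

/-- The same at every ambient format, for corner-type level vectors. [this node] -/
theorem evalT_eq_zero_of_permT_eq_self_corner {m k : ℕ} (hNm : m' + 1 ≤ m) (σ : Equiv.Perm (Fin 3)) {χ' : ℂ}
    (hχ : χ' ≠ 1)
    (hV : ∀ G ∈ hwvSpace (rectType (m' + 1) m' k) (k * m'), MvPolynomial.rename (slotPerm σ) G = χ' • G)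
    {F : MvPolynomial (Idx m) ℂ} (hF : F ∈ hwvSpace (rectType m (m' + 1) k) (k * (m' + 1)))
    {r : ℕ} (hr : (k - 1) * r < k * (m' + 1)) {t : Tensor ℂ m} (ht : tensorRank t ≤ r) (hsym : permT σ t = t) :
    evalT t F = 0 := by
  have h := evalT_permT_eq_slotChar_mul_corner hNm σ hV hF hr ht
  rw [hsym] at h
  have h2 : (χ' - 1) * evalT t F = 0 := by rw [sub_mul, one_mul, ← h, sub_self]
  exact (mul_eq_zero.1 h2).resolve_left (sub_ne_zero.2 hχ)

/-- In particular (`t = ⟨m'+1⟩`, which is `S₃`-symmetric of rank `≤ m' + 1`): if some `σ` acts on `R_k(m')` by `χ' ≠ 1`, then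
EVERY level-`k` vector of format `m' + 1` (`k ≥ 1`) vanishes AT THE UNIT TENSOR `⟨m'+1⟩`. [this node] -/
theorem evalT_unitTensor_eq_zero_of_slotChar_ne_one {k : ℕ} (hk : 1 ≤ k) (σ : Equiv.Perm (Fin 3)) {χ' : ℂ} (hχ : χ' ≠ 1)
    (hV : ∀ G ∈ hwvSpace (rectType (m' + 1) m' k) (k * m'), MvPolynomial.rename (slotPerm σ) G = χ' • G)
    {f : MvPolynomial (Idx (m' + 1)) ℂ} (hf : f ∈ hwvSpace (rectType (m' + 1) (m' + 1) k) (k * (m' + 1))) :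
    evalT (unitTensor ℂ (m' + 1)) f = 0 := by
  have hr : (k - 1) * (m' + 1) < k * (m' + 1) := by
    have : k - 1 < k := by omega
    exact Nat.mul_lt_mul_of_pos_right this (Nat.succ_pos m')
  exact evalT_eq_zero_of_permT_eq_self σ hχ hV hf hr (tensorRank_unitTensor_le' (m' + 1)) (permT_unitTensor σ)

/-- … and at every `S₃`-symmetric point of an ambient format: corner-type level vectors of block format `m' + 1` vanish at the
ambient unit tensor `⟨m⟩` whenever `(k−1)·m < k·(m'+1)`. [this node] -/
theorem evalT_unitTensor_eq_zero_of_slotChar_ne_one_corner {m k : ℕ} (hNm : m' + 1 ≤ m) (hm : (k - 1) * m < k * (m' + 1))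
    (σ : Equiv.Perm (Fin 3)) {χ' : ℂ} (hχ : χ' ≠ 1)
    (hV : ∀ G ∈ hwvSpace (rectType (m' + 1) m' k) (k * m'), MvPolynomial.rename (slotPerm σ) G = χ' • G)
    {F : MvPolynomial (Idx m) ℂ} (hF : F ∈ hwvSpace (rectType m (m' + 1) k) (k * (m' + 1))) :
    evalT (unitTensor ℂ m) F = 0 :=
  evalT_eq_zero_of_permT_eq_self_corner hNm σ hχ hV hF hm (tensorRank_unitTensor_le' m) (permT_unitTensor σ)

/-- Point-level language: under a nontrivial corner character, `k` is not a level of any `σ`-symmetric point of rank `≤ r`,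
`(k−1)r < k(m'+1)` (block format `m' + 1`, any ambient format). [this node] -/
theorem not_mem_pointLevels_of_permT_eq_self {m k : ℕ} (hNm : m' + 1 ≤ m) (σ : Equiv.Perm (Fin 3)) {χ' : ℂ} (hχ : χ' ≠ 1)
    (hV : ∀ G ∈ hwvSpace (rectType (m' + 1) m' k) (k * m'), MvPolynomial.rename (slotPerm σ) G = χ' • G)
    {r : ℕ} (hr : (k - 1) * r < k * (m' + 1)) {t : Tensor ℂ m} (ht : tensorRank t ≤ r) (hsym : permT σ t = t) :
    k ∉ pointLevels (m' + 1) t := by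
  rintro ⟨F, hF, hne⟩
  exact hne (evalT_eq_zero_of_permT_eq_self_corner hNm σ hχ hV hF hr ht hsym)

/-- **Trivial corner character ⇒ symmetry on `σ_r`:** if `σ` acts trivially on `R_k(m')`, level-`k` functions of format
`m' + 1` are `σ`-symmetric on tensors of rank `≤ r`, `(k−1)r < k(m'+1)`. [this node] -/
theorem evalT_permT_eq_of_slotChar_one {k : ℕ} (σ : Equiv.Perm (Fin 3))
    (hV : ∀ G ∈ hwvSpace (rectType (m' + 1) m' k) (k * m'), MvPolynomial.rename (slotPerm σ) G = G)
    {f : MvPolynomial (Idx (m' + 1)) ℂ} (hf : f ∈ hwvSpace (rectType (m' + 1) (m' + 1) k) (k * (m' + 1)))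
    {r : ℕ} (hr : (k - 1) * r < k * (m' + 1)) {t : Tensor ℂ (m' + 1)} (ht : tensorRank t ≤ r) :
    evalT (permT σ t) f = evalT t f := by
  have h := evalT_permT_eq_slotChar_mul σ (χ' := 1) (fun G hG => by rw [one_smul]; exact hV G hG) hf hr ht
  rwa [one_mul] at h

/-- Isotypic reading of part Z: the `σ`-eigenvectors of `R_k(m'+1)` of eigenvalue `≠ χ'` vanish on `σ_r` — one line from the
transfer law (the statement itself is part Z's `evalT_eq_zero_of_slotChar_clash`; here the value identity behind it). [bookkeeping] -/
theorem slotChar_mul_evalT_eq {k : ℕ} (σ : Equiv.Perm (Fin 3)) {χ χ' : ℂ}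
    (hV : ∀ G ∈ hwvSpace (rectType (m' + 1) m' k) (k * m'), MvPolynomial.rename (slotPerm σ) G = χ' • G)
    {f : MvPolynomial (Idx (m' + 1)) ℂ} (hf : f ∈ hwvSpace (rectType (m' + 1) (m' + 1) k) (k * (m' + 1)))
    (hfχ : MvPolynomial.rename (slotPerm σ) f = χ • f) {r : ℕ} (hr : (k - 1) * r < k * (m' + 1))
    {t : Tensor ℂ (m' + 1)} (ht : tensorRank t ≤ r) : χ * evalT t f = χ' * evalT t f := by
  rw [← evalT_permT_of_slotChar σ hfχ t, evalT_permT_eq_slotChar_mul σ hV hf hr ht]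

end Transfer

/-! ### §4 Level `3`, formats `5` and `6` -/

section LevelThree

/-- **Format `5`: level-`3` functions are transposition-ODD on `σ₇`.**  If a slot permutation `σ` acts by `−1` on the corner
space `R₃(4)` (type `((3⁴))³` in format `5`; classically `ℂ·G₄`, census χ = −1 for a transposition), then every level-`3`
vector `f` of format `5` satisfies `f(σ·t) = −f(t)` for `R(t) ≤ 7`. [this node] -/
theorem evalT_permT_level_three_five (σ : Equiv.Perm (Fin 3))
    (hV : ∀ G ∈ hwvSpace (rectType 5 4 3) (3 * 4), MvPolynomial.rename (slotPerm σ) G = (-1 : ℂ) • G)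
    {f : MvPolynomial (Idx 5) ℂ} (hf : f ∈ hwvSpace (rectType 5 5 3) (3 * 5)) {t : Tensor ℂ 5} (ht : tensorRank t ≤ 7) :
    evalT (permT σ t) f = -evalT t f := by
  have h := evalT_permT_eq_slotChar_mul (m' := 4) σ hV hf (r := 7) (by norm_num) ht
  rwa [neg_one_mul] at h

/-- … hence they vanish at every `σ`-symmetric tensor of rank `≤ 7` (format `5`). [this node] -/
theorem evalT_eq_zero_level_three_five_of_permT_eq_self (σ : Equiv.Perm (Fin 3))
    (hV : ∀ G ∈ hwvSpace (rectType 5 4 3) (3 * 4), MvPolynomial.rename (slotPerm σ) G = (-1 : ℂ) • G)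
    {f : MvPolynomial (Idx 5) ℂ} (hf : f ∈ hwvSpace (rectType 5 5 3) (3 * 5)) {t : Tensor ℂ 5} (ht : tensorRank t ≤ 7)
    (hsym : permT σ t = t) : evalT t f = 0 :=
  evalT_eq_zero_of_permT_eq_self (m' := 4) σ (by norm_num) hV hf (r := 7) (by norm_num) ht hsym

/-- **Format `6`: level-`3` functions are transposition-EVEN on `σ₈`.**  If `σ` acts trivially on the corner space `R₃(5)`
(classically `ℂ·H₅`, census χ = +1 for a transposition), then every level-`3` vector `f` of format `6` satisfies
`f(σ·t) = f(t)` for `R(t) ≤ 8`. [this node] -/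
theorem evalT_permT_level_three_six (σ : Equiv.Perm (Fin 3))
    (hV : ∀ G ∈ hwvSpace (rectType 6 5 3) (3 * 5), MvPolynomial.rename (slotPerm σ) G = G)
    {f : MvPolynomial (Idx 6) ℂ} (hf : f ∈ hwvSpace (rectType 6 6 3) (3 * 6)) {t : Tensor ℂ 6} (ht : tensorRank t ≤ 8) :
    evalT (permT σ t) f = evalT t f :=
  evalT_permT_eq_of_slotChar_one (m' := 5) σ hV hf (r := 8) (by norm_num) ht

end LevelThree

end Summit.MatrixMultiplication.MatrixMultiplication.Theorems.ObstructionCalculus
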